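import Mathlib
import Summits.ValiantsHypothesis.ValiantsHypothesis.Theorems.BorderApolarityToricFixedPointsToricLimitIsInitial
import Summits.ValiantsHypothesis.ValiantsHypothesis.Theorems.BorderApolarityBorelFixedBorderApolarityTranslate
import Summits.ValiantsHypothesis.ValiantsHypothesis.Theorems.BorderApolarityBorelFixedBorderApolarityDescentA

/-!
# Border apolarity, support item `BorelFixedBorderApolarity` — rank profile of the initial span

Route `ValiantsHypothesis/BorderApolarity`, support item `stmt-ValiantsHypothesis-5781`, helper
file (descent algebra, part B).  For an integer weight `μ` and a subspace `A` of degree-`k` forms,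
the INITIAL SPAN `in_μ(A)` (span of the lowest-`μ`-weight forms of the elements of `A`, the torus
limit `lim_{s→0} diag(s^{-μ}) · A` of the crux files `ToricLimitIsInitial*`) is a graded subspace of
degree-`k` forms with

* `bfba_finrank_initSpan` — `dim in_μ(A) = dim A` (the moving planes `diag((t+2)^μ)⁻¹ A`
  Kuratowski-converge to `in_μ(A)` by `tli_exists_approx` / `tli_limitMem`, and Kuratowski limits of
  `d`-planes are `d`-planes, `stub_kuratowskiSubmodule`);
* `bfba_initSpan_inf_Fge` — `in_μ(A) ∩ F_{≥ν} = in_μ(A ∩ F_{≥ν})`, hence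
* `bfba_rank_initSpan` — **`dim (in_μ(A) ∩ F_{≥ν}) = dim (A ∩ F_{≥ν})` for every `ν`**: taking
  the initial span does not change the rank profile that the descent of the support item decreases.

Folklore (flatness of torus degenerations in a Grassmannian, filtered version).
-/

open MvPolynomial Filter
open scoped BigOperators Topology

namespace Summit.ValiantsHypothesis.ValiantsHypothesis.Theorems.BorderApolarityBorelFixedBorderApolarity

set_option linter.dupNamespace false

open Literature.Computability.AlgebraicComplexity
open Summit.ValiantsHypothesis.ValiantsHypothesis.Theorems.BorderApolarityToricFixedPoints
open Summit.ValiantsHypothesis.ValiantsHypothesis.Theorems.BorderApolarityFixedWitnessObstructionQP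
  (stub_kuratowskiSubmodule)

variable {σ : Type} [Fintype σ] [DecidableEq σ] (μ : σ → ℤ)


omit [Fintype σ] [DecidableEq σ] in
/-- If all weight components of `E` below `ν₁` vanish then `E ∈ F_{≥ν₁}`. [folklore] -/
theorem bfba_mem_Fge_of_low_comp_zero {ν₁ : ℤ} {E : MvPolynomial σ ℂ}
    (hlow : ∀ ν' : ℤ, ν' < ν₁ → weightedHomogeneousComponent μ ν' E = 0) :
    E ∈ restrictSupport ℂ {e : σ →₀ ℕ | ν₁ ≤ Finsupp.weight μ e} := by
  rw [bfba_mem_Fge]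
  intro e he
  by_contra hlt
  push Not at hlt
  have h0 := tli_coeff_eq_zero_of_weightedHomogeneousComponent_eq_zero μ (hlow _ hlt) (d := e) rfl
  exact (mem_support_iff.1 he) h0

omit [Fintype σ] [DecidableEq σ] in
/-- Components of an element of `F_{≥ν}` below `ν` vanish. [folklore] -/
theorem bfba_comp_eq_zero_of_mem_Fge {ν ν' : ℤ} (h : ν' < ν) {E : MvPolynomial σ ℂ}
    (hE : E ∈ restrictSupport ℂ {e : σ →₀ ℕ | ν ≤ Finsupp.weight μ e}) :
    weightedHomogeneousComponent μ ν' E = 0 := by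
  rw [bfba_mem_Fge] at hE
  ext e
  rw [coeff_weightedHomogeneousComponent, coeff_zero]
  split_ifs with hw
  · by_contra hne
    have := hE e (mem_support_iff.2 hne)
    omega
  · rfl

omit [Fintype σ] [DecidableEq σ] in
/-- The initial span consists of degree-`k` forms. [folklore] -/
theorem bfba_initSpan_le_hom (k : ℕ) (A : Submodule ℂ (MvPolynomial σ ℂ))
    (hA : A ≤ homogeneousSubmodule σ ℂ k) :
    Submodule.span ℂ {D : MvPolynomial σ ℂ | ∃ E ∈ A, ∃ ν : ℤ,
      D = weightedHomogeneousComponent μ ν E ∧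
        ∀ ν' : ℤ, ν' < ν → weightedHomogeneousComponent μ ν' E = 0} ≤ homogeneousSubmodule σ ℂ k := by
  refine Submodule.span_le.2 ?_
  rintro _ ⟨E, hE, ν, rfl, -⟩
  exact (mem_homogeneousSubmodule k _).2 (tli_isHomogeneous_weightedHomogeneousComponent μ ν
    ((mem_homogeneousSubmodule k E).1 (hA hE)))

/-- **Flatness, both ways: `dim in_μ(A) = dim A`** for a subspace `A` of degree-`k` forms.  The
planes `diag((t+2)^μ)⁻¹ A` (all of dimension `dim A`) Kuratowski-converge to `in_μ(A)`
(`tli_exists_approx`, `tli_limitMem`), and a Kuratowski limit of `d`-planes is a `d`-plane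
(`stub_kuratowskiSubmodule`). [folklore] -/
theorem bfba_finrank_initSpan (k : ℕ) (A : Submodule ℂ (MvPolynomial σ ℂ))
    (hA : A ≤ homogeneousSubmodule σ ℂ k) :
    Module.finrank ℂ ↥(Submodule.span ℂ {D : MvPolynomial σ ℂ | ∃ E ∈ A, ∃ ν : ℤ,
      D = weightedHomogeneousComponent μ ν E ∧
        ∀ ν' : ℤ, ν' < ν → weightedHomogeneousComponent μ ν' E = 0}) = Module.finrank ℂ A := by
  haveI : Module.Finite ℂ (homogeneousSubmodule σ ℂ k) :=
    Module.Finite.iff_fg.2 (homogeneousSubmodule_fg σ ℂ k)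
  haveI : FiniteDimensional ℂ A := Submodule.finiteDimensional_of_le hA
  have hc0 : ∀ s : ℕ, ((s : ℂ) + 2) ≠ 0 := tli_natCast_add_two_ne_zero
  set B : ℕ → Submodule ℂ (MvPolynomial σ ℂ) := fun s =>
    A.comap (linSubst σ ℂ (Matrix.diagonal fun i => ((s : ℂ) + 2) ^ μ i)).toLinearMap with hB
  have hBmem : ∀ (s : ℕ) (H : MvPolynomial σ ℂ),
      H ∈ B s ↔ linSubst σ ℂ (Matrix.diagonal fun i => ((s : ℂ) + 2) ^ μ i) H ∈ A :=
    fun s H => Iff.rfl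
  have hunit : ∀ s : ℕ, IsUnit (Matrix.diagonal fun i : σ => ((s : ℂ) + 2) ^ μ i).det :=
    fun s => tli_isUnit_det_diagonal_zpow _ (hc0 s) μ
  have hBle : ∀ s, B s ≤ homogeneousSubmodule σ ℂ k := by
    intro s H hH
    rw [hBmem] at hH
    have h1 := (mem_homogeneousSubmodule k _).1 (hA hH)
    exact (mem_homogeneousSubmodule k H).2 ((bfba_isHomogeneous_linSubst_iff _ (hunit s) H k).1 h1)
  have hBd : ∀ s, Module.finrank ℂ (B s) = Module.finrank ℂ A := fun s =>
    tli_finrank_comap_linSubst _ (hunit s) A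
  set L := Submodule.span ℂ {D : MvPolynomial σ ℂ | ∃ E ∈ A, ∃ ν : ℤ,
      D = weightedHomogeneousComponent μ ν E ∧
        ∀ ν' : ℤ, ν' < ν → weightedHomogeneousComponent μ ν' E = 0} with hL
  obtain ⟨Lk, hLk, -, hfin⟩ := stub_kuratowskiSubmodule k (Module.finrank ℂ A) B (L : Set (MvPolynomial σ ℂ))
    hBle hBd
    (fun D hD => by
      obtain ⟨H, hH, hlim⟩ := tli_exists_approx μ k A hA tendsto_id hD
      exact ⟨H, fun t => (hBmem t (H t)).2 (hH t).2, hlim⟩)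
    (fun D φ Ds hφ hDs hlim => tli_limitMem μ k A hA hφ (fun t => (hBmem _ _).1 (hDs t)) hlim)
  have hLkL : Lk = L := SetLike.coe_injective hLk
  rw [← hLkL, hfin]

omit [Fintype σ] in
/-- **Filtering commutes with taking initial spans**: `in_μ(A) ∩ F_{≥ν} = in_μ(A ∩ F_{≥ν})`.
`⊇`: a lowest form of an element of `A ∩ F_{≥ν}` has weight `≥ ν`.  `⊆`: an element of the
(graded) initial span lying in `F_{≥ν}` is the sum of its components of weight `ν' ≥ ν`, and the
`ν'`-component of a generator `in(E)` is `in(E)` (then `E ∈ F_{≥ν'} ⊆ F_{≥ν}`) or `0`. [folklore] -/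
theorem bfba_initSpan_inf_Fge (A : Submodule ℂ (MvPolynomial σ ℂ)) (ν : ℤ) :
    Submodule.span ℂ {D : MvPolynomial σ ℂ | ∃ E ∈ A, ∃ ν : ℤ,
      D = weightedHomogeneousComponent μ ν E ∧
        ∀ ν' : ℤ, ν' < ν → weightedHomogeneousComponent μ ν' E = 0} ⊓
      restrictSupport ℂ {e : σ →₀ ℕ | ν ≤ Finsupp.weight μ e} =
    Submodule.span ℂ {D : MvPolynomial σ ℂ |
      ∃ E ∈ A ⊓ restrictSupport ℂ {e : σ →₀ ℕ | ν ≤ Finsupp.weight μ e}, ∃ ν : ℤ,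
      D = weightedHomogeneousComponent μ ν E ∧
        ∀ ν' : ℤ, ν' < ν → weightedHomogeneousComponent μ ν' E = 0} := by
  set L := Submodule.span ℂ {D : MvPolynomial σ ℂ | ∃ E ∈ A, ∃ ν : ℤ,
      D = weightedHomogeneousComponent μ ν E ∧
        ∀ ν' : ℤ, ν' < ν → weightedHomogeneousComponent μ ν' E = 0} with hL
  set L' := Submodule.span ℂ {D : MvPolynomial σ ℂ |
      ∃ E ∈ A ⊓ restrictSupport ℂ {e : σ →₀ ℕ | ν ≤ Finsupp.weight μ e}, ∃ ν : ℤ,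
      D = weightedHomogeneousComponent μ ν E ∧
        ∀ ν' : ℤ, ν' < ν → weightedHomogeneousComponent μ ν' E = 0} with hL'
  apply le_antisymm
  · -- `⊆`
    rintro x ⟨hxL, hxF⟩
    have hxF' := (bfba_mem_Fge μ).1 hxF
    rw [← cr_sum_comp (μ := μ) x]
    refine Submodule.sum_mem _ fun ν' hν' => ?_
    obtain ⟨e, he, rfl⟩ := Finset.mem_image.1 hν'
    have hνe : ν ≤ Finsupp.weight μ e := hxF' e he
    -- the `ν'`-component of the generators
    have hmap : L.map (weightedHomogeneousComponent μ (Finsupp.weight μ e)) ≤ L' := by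
      rw [hL, Submodule.map_span, Submodule.span_le]
      rintro _ ⟨g, ⟨E, hEA, ν₁, rfl, hlow⟩, rfl⟩
      rw [SetLike.mem_coe, tli_weightedHomogeneousComponent_weightedHomogeneousComponent]
      split_ifs with h
      · have hE := bfba_mem_Fge_of_low_comp_zero μ hlow
        have hEF : E ∈ restrictSupport ℂ {e : σ →₀ ℕ | ν ≤ Finsupp.weight μ e} := by
          rw [bfba_mem_Fge] at hE ⊢
          intro e' he'
          have := hE e' he'
          omega
        exact Submodule.subset_span ⟨E, ⟨hEA, hEF⟩, ν₁, rfl, hlow⟩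
      · exact Submodule.zero_mem _
    exact hmap (Submodule.mem_map_of_mem hxL)
  · -- `⊇`
    rw [hL', Submodule.span_le]
    rintro _ ⟨E, ⟨hEA, hEF⟩, ν₁, rfl, hlow⟩
    refine ⟨Submodule.subset_span ⟨E, hEA, ν₁, rfl, hlow⟩, ?_⟩
    by_cases h : ν ≤ ν₁
    · exact bfba_comp_mem_Fge μ h E
    · rw [SetLike.mem_coe, bfba_comp_eq_zero_of_mem_Fge μ (not_le.1 h) hEF]
      exact Submodule.zero_mem _

/-- **The initial span has the rank profile of `A`**: `dim (in_μ(A) ∩ F_{≥ν}) = dim (A ∩ F_{≥ν})`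
for every `ν` and every subspace `A` of degree-`k` forms. [folklore] -/
theorem bfba_rank_initSpan (k : ℕ) (A : Submodule ℂ (MvPolynomial σ ℂ))
    (hA : A ≤ homogeneousSubmodule σ ℂ k) (ν : ℤ) :
    Module.finrank ℂ ↥(Submodule.span ℂ {D : MvPolynomial σ ℂ | ∃ E ∈ A, ∃ ν : ℤ,
      D = weightedHomogeneousComponent μ ν E ∧
        ∀ ν' : ℤ, ν' < ν → weightedHomogeneousComponent μ ν' E = 0} ⊓
      restrictSupport ℂ {e : σ →₀ ℕ | ν ≤ Finsupp.weight μ e}) =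
    Module.finrank ℂ ↥(A ⊓ restrictSupport ℂ {e : σ →₀ ℕ | ν ≤ Finsupp.weight μ e}) := by
  rw [bfba_initSpan_inf_Fge μ A ν]
  exact bfba_finrank_initSpan μ k _ (inf_le_left.trans hA)

omit [Fintype σ] [DecidableEq σ] in
/-- **The initial span is graded**: it is spanned by weight vectors, so it contains the weight
components of its elements (stated for the span over any set of polynomials). [folklore] -/
theorem bfba_initSpan_graded_set (S : Set (MvPolynomial σ ℂ)) :
    ∀ D ∈ Submodule.span ℂ {D : MvPolynomial σ ℂ | ∃ E ∈ S, ∃ ν : ℤ,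
      D = weightedHomogeneousComponent μ ν E ∧
        ∀ ν' : ℤ, ν' < ν → weightedHomogeneousComponent μ ν' E = 0},
    ∀ ν : ℤ, weightedHomogeneousComponent μ ν D ∈ Submodule.span ℂ {D : MvPolynomial σ ℂ | ∃ E ∈ S,
      ∃ ν : ℤ, D = weightedHomogeneousComponent μ ν E ∧
        ∀ ν' : ℤ, ν' < ν → weightedHomogeneousComponent μ ν' E = 0} := by
  intro D hD ν
  induction hD using Submodule.span_induction with
  | mem x hx =>
    obtain ⟨E, hES, ν₁, rfl, hlow⟩ := hx
    rw [tli_weightedHomogeneousComponent_weightedHomogeneousComponent]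
    split_ifs with h
    · exact Submodule.subset_span ⟨E, hES, ν₁, rfl, hlow⟩
    · exact Submodule.zero_mem _
  | zero => rw [map_zero]; exact Submodule.zero_mem _
  | add x y _ _ hx hy => rw [map_add]; exact Submodule.add_mem _ hx hy
  | smul a x _ hx => rw [map_smul]; exact Submodule.smul_mem _ a hx

end Summit.ValiantsHypothesis.ValiantsHypothesis.Theorems.BorderApolarityBorelFixedBorderApolarity
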